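import Literature.NumberTheory.EllipticCurves.PAdicBSD
import Literature.NumberTheory.EllipticCurves.LeadingTerm
import Literature.Barriers.BirchSwinnertonDyer.ExceptionalZero
import Summits.BirchSwinnertonDyer.BirchSwinnertonDyer.Theses.LeadingTerm
import HarnessLib

/-!
# Line `RungMultSelfAux` — forward rung R9⁰′ on crux `KatoDivisibility` (route `LeadingTerm`)

FORWARD / next-rung generator G1 (unit `fwd-rung-BirchSwinnertonDyer-03`, seed `g1-BSD-rank1-R9`,
cell "BSD: 1c/1d non-CM, with auxiliary prime (F) → no auxiliary prime (R9)", instances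
`11a1@11`, `17a1@17`, `19a1@19` (analytic rank 0, `N = p`)). Host crux: `LeadingTerm.KatoDivisibility`
(stmt-BirchSwinnertonDyer-18082) — the upper-bound / main-conjecture half of the route, the item whose
technique class (Kato's Euler system + Iwasawa main conjecture) this rung extends to `p ‖ N` without an
auxiliary prime `q ≠ p`. This skeleton concludes the RUNG (`Rung_mult_selfaux_r0_proof`), not the crux and
not the summit: a forward rung is a theorem-to-be one move above the floor, filed as a LINE (brief F2/F6).

## (1) The rung and its floor — ONE move

FLOOR (in print): Skinner 2016, Thm. C [Skinner2016PacificMC = arXiv:1407.1093, p. 3]: `E/ℚ`, `p ≥ 3` a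
prime of multiplicative reduction, (irr) `E[p]` irreducible, (ram) "there exists a prime `q ≠ p` such that
`q ‖ N` and `E[p]` is ramified at `q`", `L(E,1) ≠ 0` ⟹ `|L(E,1)/Ω_E|_p⁻¹ = |#Ш(E) · ∏_ℓ c_ℓ(E)|_p⁻¹`
— the named fact `Skinner2016_thmC` below (binders copied from the tree's bsd.S30
`Literature.NumberTheory.EllipticCurves.padicValRat_bsd_rank_zero`, with `hgood, hord` replaced by
`hmult` and WITHOUT `hsurj`: Skinner's footnote, p. 3, "(irr)+(ram) suffice for the equality in Λ").

RUNG `Rung_mult_selfaux_r0` (this file): the same statement with (ram) GENERALISED to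
(ram′) "there is a multiplicative prime `ℓ` — `ℓ = p` ALLOWED — with `p ∤ ord_ℓ(Δ_min)`".
One move: the admissible set of auxiliary primes grows from `{ℓ ≠ p}` to all `ℓ`; nothing else changes
(`3 ≤ p`, (irr), `r_an = 0`, the conclusion are verbatim). The graded family is `RungMultR0 A`
(antitone in the admissibility predicate `A`, `rungMultR0_anti`): floor `= RungMultR0 (ℓ ≠ p)`
(`floor_iff_thmC : Floor ↔ Skinner2016_thmC`, definitional), rung `= RungMultR0 ⊤`, next rung
`Rung_mult_noaux_r0` (no auxiliary hypothesis at all) with `Rung_mult_noaux_r0 → Rung_mult_selfaux_r0 →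
Floor` (`selfaux_of_noaux`, `floor_of_selfaux`). New instances covered: every curve of prime conductor
`N = p ≥ 3` with `E[p]` irreducible, `L(E,1) ≠ 0` and `p ∤ ord_p(Δ)` — `11a1@11` (`Δ = -11⁵`), `17a1@17`
(`Δ = -17⁴`), `19a1@19` (`Δ = -19³`) — for which (ram) is vacuous (no second bad prime); as single curves
their BSD is machine-verified [Miller2011LMS], the rung is the first UNIFORM statement containing them.
SEMISTABLE DIVIDEND (sorry-free, `semistableNoAux_of_selfaux`): for semistable `E` the self-auxiliary rung
is ALREADY the auxiliary-free statement `SemistableNoAuxR0`, given the named fact `RibetAuxPrime`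
[Ribet1990, Thm. 1.1 + the Tate-curve finiteness criterion]: if `E[p]` is unramified at every bad `ℓ ≠ p`
and finite at `p` (`p ∣ ord_p Δ`), level lowering makes `ρ̄_{E,p}` modular of weight 2 and level 1 —
absurd; so either Skinner's `q ≠ p` exists or `p ∤ ord_p(Δ)` and `ℓ = p` is admissible. (This is the
`p ∣ N` half of the remark "(ram) automatically holds in the semistable case", Castella 2018 §5 ¶1 /
BSTW24 §1.5, which in print is made only for `p ∤ N`.)

## (2) What is easy at the floor's parameter and hard at the rung's

At the floor, the auxiliary `q ≠ p` does two jobs in Skinner's proof of Thm. A (§3.1, steps (d)–(e),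
arXiv:1407.1093 p. 13): (α) Kato's INTEGRAL divisibility for the congruent good-weight forms `f_m`
needs an element `g ∈ G_{ℚ(μ_{p^∞})}` with `T/(ρ(g)-1)T` free of rank one, supplied by a tame inertia
generator at `q` (ibid. p. 11, hypothesis (b)); (β) Skinner–Urban's Eisenstein-congruence lower bound
(SU14 Thm. 3.6.4 (iii)) needs `q` INERT in the auxiliary imaginary quadratic `K` for Vatsal/Chida–Hsieh
non-vanishing mod `p`. With `ℓ = p` allowed, (α) survives — a multiplicative `p` is its own auxiliary
prime: for `g` in the inertia group of `ℚ_p(μ_{p^∞})`, `ρ_{E,p}(g) = (1 b(g); 0 1)` with `b` the Kummer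
cocycle of the Tate parameter `q_E`, and `b ≢ 0 mod p` for some such `g` iff `q_E^{1/p} ∉ ℚ_p^{ab}` iff
(`p` odd) `q_E ∉ (ℚ_p^×)^p`, implied by `p ∤ ord_p(q_E) = ord_p(Δ_min)` — but (β) does NOT: `p` splits in
`K`, so it can never be S–U's inert ramified prime, and for `N = p` there is no other candidate. The hard
new input is therefore the `p ‖ N` transplant of Burungale–Castella–Skinner's base-change argument
(arXiv:2405.00270, Thm. 1.1.2: auxiliary prime removed at GOOD ordinary `p ≥ 5` via Wan's `U(3,1)`
divisibility over a quartic CM field, `n⁻ = 1`), whose every printed ingredient is stated for `p ∤ N`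
(Wan, Thm. 3.2.1 "p > 3 good ordinary"; BSTW zeta element, Thm. 4.1.3 "p ∤ 2N"; Hsieh's `μ = 0`,
Prop. 4.2.2, good reduction) — stub `stub_lower_noinert_ge5` (hardest), with the `p = 3` sub-case, where
even Wan's engine is absent, isolated as `stub_lower_noinert_three`.

## (3) What a proof of the rung forces into view

The cyclotomic main conjecture for `E` at a multiplicative prime `p` under (irr) alone on the lower-bound
side: `char_Λ X(E/ℚ_∞) = (L_p(E,T)/corr_p)` INTEGRALLY, `corr_p = T` (split) / `1` (non-split) — i.e. the
three-variable Eisenstein/base-change machine run through a `p`-new weight-2 point of the Hida family,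
with integrality from `μ(L_𝔭^{BDP}(f)) = 0` at `p ‖ N` (variation of anticyclotomic `μ` in Hida families)
instead of from an inert ramified prime. As a named intermediate object: the classical Selmer dual at
`p ‖ N` with its exceptional-zero correction (`multCorr`), on which BOTH divisibilities are typed below.

## (4) Where the floor's proof stops

[Skinner2016PacificMC, §3.1 (d)–(e), arXiv:1407.1093 p. 13 L28–L60]: the integral main conjecture for each
`f_m ∈ S_{k_m}(Γ₀(N/p))` is imported from Thm. 9 = SU14 Thm. 3.6.4, whose hypothesis (iii) IS (ram); the
mod-`p^m` transfer `(Ch(f), p^m) = (L_f, p^m)` needs the INTEGRAL equality for every `m`, so a `Λ ⊗ ℚ_p`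
substitute (Wan 2015, Thm. 4) does not pass through the congruences. [Castella2018, §5, arXiv:1704.06608
p. 12 L3–L8 and L45–L49]: in analytic rank 1 the same `q` is used to kill `c_w(E/K)` at `w ∣ q` — the
`r = 1` rung of this family (not filed here) stops there.

## (5) Prior attempts above the floor

* Burungale–Castella–Skinner 2024/25 [BurungaleCastellaSkinner2025, Thm. 1.1.2, Cor. 1.3.1; tree fact
  `burungale_castella_skinner_charIdeal_eq_padicLFunction`, tree theorem
  `…_of_baseChange_divisibility`]: (ram) removed at GOOD ordinary `p > 3`; in `Λ ⊗ ℚ_p` under (irr), in `Λ`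
  under (irr)+(im). Multiplicative `p` not treated (every input `p ∤ N`).
* Wan 2015 [Wan2015HilbertMC, Thm. 4]: (ram) removed from SU14 up to `⊗ ℚ_p`, `p ∤ N`.
* Fouquet–Wan, arXiv:2107.13726 (PREPRINT): main conjecture "for all modular motives incl. p | N"
  claimed in `Λ ⊗ ℚ_p` under residual conditions — unrefereed; `⊗ ℚ_p` only, so no `p`-part.
* Skinner–Zhang 2014 [SkinnerZhang2014 = arXiv:1407.1099, Thms. 1.1–1.3, p. 3]: `p`-converse and
  rank-1 `p`-part at multiplicative `p ≥ 5`; their hypothesis (b) "`p ∤ ord_p(Δ)` (`E[p]` not finite at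
  `p`)" IS our self-auxiliary condition, but it is imposed IN ADDITION to (e) "at least two `ℓ ‖ N` with
  `p ∤ ord_ℓ(Δ)`" (so an auxiliary `ℓ ≠ p` remains) and to an `𝓛`-invariant condition; their rank-0 input
  (p. 22, hyp. (b)) is again Skinner's Thm. C with `q ≠ p`. Nobody in print uses `p ∤ ord_p(Δ)` to
  DISCHARGE Kato's hypothesis (b) — that is the lever of this line.
* Instances: BSD for the three seed curves is verified individually by computation [Miller2011LMS]
  (conductor `< 5000`, rank `≤ 1`); no uniform statement covers them.
No printed claim of the rung; no refutation known (BSD predicts it).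

## Stubs (five; sorries only here) and composition

`stub_kato_integral_selfaux` (α at `p ‖ N`, integral, self-auxiliary prime) · `stub_lower_noinert_ge5`
(β at `p ‖ N`, `p ≥ 5`, HARDEST) · `stub_lower_noinert_three` (β at `p = 3`, no engine in print) ·
`stub_greenberg_stevens` (tree fact bsd.S24′ `greenberg_stevens`, in print) · `stub_descent_r0`
(Skinner 2016 §3.2–3.3, (ram)-free descent from the two divisibilities + Greenberg–Stevens to the
`p`-part). `Rung_mult_selfaux_r0_proof : Rung_mult_selfaux_r0` composes them (case split `p = 3 ∨ 5 ≤ p`);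
`rung_of_stubs` is the closed (sorry-free) composition with the five statements as hypotheses.

Barrier `Literature.Barriers.BirchSwinnertonDyer.ExceptionalZeroBarrier(Narrow)`: the typed divisibilities
carry the correction `multCorr W p = T` at split `p` (the classical Selmer dual has characteristic ideal
`(L_p/T)`, Skinner 2016 §3.3), so the blocked shape `char X_classical = (L_p)` never occurs
(`constantCoeff_eq_zero_of_katoSide_split`: the typed Kato identity FORCES `L_p(0) = 0` at split `p`);
`𝓛_p(E) ≠ 0` is the tree theorem `LInvariant_ne_zero_holds`. Disproof used: none exists
(`Cruxes/KatoDivisibility/` has no `Disproof.lean`). Negatives index: only `LeadingTerm.TamePinch`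
(refuted by `32a2`, additive reduction at 2) — unrelated (multiplicative `p ≥ 3` here).
-/

set_option linter.dupNamespace false
set_option autoImplicit false

noncomputable section

open scoped Classical

open CongruenceSubgroup WeierstrassCurve
open Literature.NumberTheory.EllipticCurves Literature.NumberTheory.EllipticCurves.ModularForms

namespace Summit.BirchSwinnertonDyer.BirchSwinnertonDyer.Cruxes.KatoDivisibility.RungMultSelfAux

/-! ### The graded family: floor < rung < next rung -/

/-- The rank-`0` `p`-part of the BSD formula in the print shape of Skinner–Urban Thm. 2 (a) /
Skinner 2016 Thm. C / the tree's bsd.S30: `L(E,1)/Ω_E` is a rational `q` with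
`ord_p q = ord_p(#Ш · ∏ c_ℓ / #E(ℚ)_tors²)`. [folklore] -/
def PPartR0 (W : WeierstrassCurve ℚ) [W.IsElliptic] [W.IsGloballyMinimal] (p : ℕ) [Fact p.Prime] :
    Prop :=
  ∃ q : ℚ, W.entireLFunction 1 / (W.realPeriodRat : ℂ) = (q : ℂ) ∧
    padicValRat p q = (padicValNat p W.shaOrder : ℤ) + padicValNat p W.tamagawaProduct -
      2 * padicValNat p W.torsionOrder

/-- The graded family `R9⁰(A)`: rank-`0` `p`-part at a multiplicative prime `p ≥ 3` under (irr) and the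
existence of an `A`-ADMISSIBLE auxiliary multiplicative prime `ℓ` at which `E[p]` is ramified
(`p ∤ ord_ℓ(Δ_min)`, Tate). Antitone in `A`. Floor: `A p ℓ := ℓ ≠ p`; rung: `A := ⊤`. [folklore] -/
def RungMultR0 (A : ℕ → ℕ → Prop) : Prop :=
  ∀ (W : WeierstrassCurve ℚ) [W.IsElliptic] [W.IsGloballyMinimal] (p : ℕ) [Fact p.Prime],
    3 ≤ p → W.HasMultiplicativeReductionAtPrime p → W.HasIrreducibleModPGaloisRep p →
    (∃ ℓ : ℕ, ∃ _ : Fact ℓ.Prime, A p ℓ ∧ W.HasMultiplicativeReductionAtPrime ℓ ∧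
        ¬ p ∣ padicValInt ℓ W.minimalDiscriminantInt) →
    W.entireLFunction 1 ≠ 0 → Finite W.sha → PPartR0 W p

/-- **FLOOR (named fact, in print): Skinner 2016, Thm. C** — C. Skinner, *Multiplicative reduction
and the cyclotomic main conjecture for GL₂*, Pacific J. Math. 283 (2016) 171–200 = arXiv:1407.1093,
Thm. C (p. 3): "Let `E/ℚ` be an elliptic curve, `p ≥ 3` a prime of good ordinary or multiplicative
reduction; (i) `E[p]` is an irreducible `G_ℚ`-representation; (ii) there exists a prime `q ≠ p` of
multiplicative reduction such that `E[p]` is ramified at `q`. (a) If `L(E,1) ≠ 0`, then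
`|L(E,1)/Ω_E|_p⁻¹ = |#Ш(E) · ∏_ℓ c_ℓ(E)|_p⁻¹`." Transcribed exactly as the tree's bsd.S30
(`padicValRat_bsd_rank_zero`: Néron period `realPeriodRat` of the globally minimal `W`; `E[p]`
ramified at the multiplicative `q` iff `p ∤ ord_q(Δ_min)`; no torsion term in print because
`E(ℚ)[p] = 0` under (irr); `hfin` makes `shaOrder` an order), restricted to the multiplicative case
and WITHOUT the surjectivity binder (footnote p. 3: (irr)+(ram) suffice). [cite: Skinner2016PacificMC, Thm. C (a)] -/
def Skinner2016_thmC : Prop :=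
  ∀ (W : WeierstrassCurve ℚ) [W.IsElliptic] [W.IsGloballyMinimal] (p : ℕ) [Fact p.Prime]
    (_hp : 3 ≤ p) (_hmult : W.HasMultiplicativeReductionAtPrime p)
    (_hirr : W.HasIrreducibleModPGaloisRep p)
    (_haux : ∃ ℓ : ℕ, ∃ _ : Fact ℓ.Prime, ℓ ≠ p ∧ W.HasMultiplicativeReductionAtPrime ℓ ∧
        ¬ p ∣ padicValInt ℓ W.minimalDiscriminantInt)
    (_hL : W.entireLFunction 1 ≠ 0) (_hfin : Finite W.sha),
    ∃ q : ℚ, W.entireLFunction 1 / (W.realPeriodRat : ℂ) = (q : ℂ) ∧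
      padicValRat p q = (padicValNat p W.shaOrder : ℤ) + padicValNat p W.tamagawaProduct -
        2 * padicValNat p W.torsionOrder

/-- The floor as the `A p ℓ := ℓ ≠ p` member of the family. [folklore] -/
def Floor_mult_aux_r0 : Prop := RungMultR0 (fun p ℓ => ℓ ≠ p)

/-- **THE RUNG (deciding)** `R9⁰′`: rank-`0` `p`-part of BSD at a multiplicative prime `p ≥ 3` under
(irr) and (ram′) "some multiplicative `ℓ`, POSSIBLY `ℓ = p`, has `p ∤ ord_ℓ(Δ_min)`". One move above
Skinner 2016 Thm. C (the admissible auxiliary set grows from `ℓ ≠ p` to all `ℓ`). Not claimed in print. [folklore] -/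
def Rung_mult_selfaux_r0 : Prop := RungMultR0 (fun _ _ => True)

/-- **NEXT RUNG** `R9⁰`: no auxiliary hypothesis at all (the exact `p ‖ N` analogue of
Burungale–Castella–Skinner Cor. 1.3.1 without (im)). [folklore] -/
def Rung_mult_noaux_r0 : Prop :=
  ∀ (W : WeierstrassCurve ℚ) [W.IsElliptic] [W.IsGloballyMinimal] (p : ℕ) [Fact p.Prime],
    3 ≤ p → W.HasMultiplicativeReductionAtPrime p → W.HasIrreducibleModPGaloisRep p →
    W.entireLFunction 1 ≠ 0 → Finite W.sha → PPartR0 W p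

/-- The family is antitone in the admissibility predicate. [folklore] -/
theorem rungMultR0_anti {A B : ℕ → ℕ → Prop} (hAB : ∀ p ℓ, A p ℓ → B p ℓ) :
    RungMultR0 B → RungMultR0 A := by
  intro h W _ _ p _ hp hm hi haux hL hfin
  obtain ⟨ℓ, hℓ, hA, hmℓ, hv⟩ := haux
  exact h W p hp hm hi ⟨ℓ, hℓ, hAB p ℓ hA, hmℓ, hv⟩ hL hfin

/-- The floor member IS Skinner's Thm. C, definitionally. [folklore] -/
theorem floor_iff_thmC : Floor_mult_aux_r0 ↔ Skinner2016_thmC :=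
  ⟨fun h W _ _ p _ hp hm hi haux hL hfin => h W p hp hm hi haux hL hfin,
   fun h W _ _ p _ hp hm hi haux hL hfin => h W p hp hm hi haux hL hfin⟩

/-- **Witness (special case, F3)**: the rung restricted to the floor's parameter (`ℓ ≠ p`) is the
floor, and the floor follows from the named fact with no `sorry`. [folklore] -/
theorem floor_of_thmC (h : Skinner2016_thmC) : Floor_mult_aux_r0 := floor_iff_thmC.2 h

/-- The rung specialises to the floor (monotonicity). [folklore] -/
theorem floor_of_selfaux (h : Rung_mult_selfaux_r0) : Floor_mult_aux_r0 :=
  rungMultR0_anti (fun _ _ _ => trivial) h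

/-! ### Semistable curves: the self-auxiliary rung is already auxiliary-free -/

/-- `W` is semistable, phrased over the Tamagawa-file vocabulary: every prime dividing the minimal
discriminant is a prime of multiplicative reduction. [folklore] -/
def IsSemistableMin (W : WeierstrassCurve ℚ) [W.IsElliptic] [W.IsGloballyMinimal] : Prop :=
  ∀ (ℓ : ℕ) [Fact ℓ.Prime], (ℓ : ℤ) ∣ W.minimalDiscriminantInt → W.HasMultiplicativeReductionAtPrime ℓ

/-- NAMED FACT (in print; Ribet's level-lowering theorem combined with the Tate-curve criterion "`E[p]` is
finite at a multiplicative `p` iff `p ∣ ord_p(Δ_min)`", exactly as used for `p ∤ N` in Castella 2018 §5 ¶1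
and JSW17 §7): for a semistable `E/ℚ`, a prime `p ≥ 3` of multiplicative reduction with `E[p]` irreducible
and finite at `p`, some bad prime `ℓ ≠ p` has `E[p]` ramified at `ℓ` (`p ∤ ord_ℓ(Δ_min)`) — otherwise
`ρ̄_{E,p}` would be modular of weight 2 and level 1. [cite: Ribet1990, Thm. 1.1] -/
def RibetAuxPrime : Prop :=
  ∀ (W : WeierstrassCurve ℚ) [W.IsElliptic] [W.IsGloballyMinimal] (p : ℕ) [Fact p.Prime],
    3 ≤ p → IsSemistableMin W → W.HasMultiplicativeReductionAtPrime p →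
    W.HasIrreducibleModPGaloisRep p → p ∣ padicValInt p W.minimalDiscriminantInt →
    ∃ ℓ : ℕ, ∃ _ : Fact ℓ.Prime, ℓ ≠ p ∧ (ℓ : ℤ) ∣ W.minimalDiscriminantInt ∧
      ¬ p ∣ padicValInt ℓ W.minimalDiscriminantInt

/-- The AUXILIARY-FREE rank-0 `p`-part statement at a multiplicative `p ≥ 3` under (irr), for semistable
curves (the semistable case of the next rung `Rung_mult_noaux_r0`). [folklore] -/
def SemistableNoAuxR0 : Prop :=
  ∀ (W : WeierstrassCurve ℚ) [W.IsElliptic] [W.IsGloballyMinimal] (p : ℕ) [Fact p.Prime],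
    3 ≤ p → IsSemistableMin W → W.HasMultiplicativeReductionAtPrime p →
    W.HasIrreducibleModPGaloisRep p → W.entireLFunction 1 ≠ 0 → Finite W.sha → PPartR0 W p

/-- SEMISTABLE DIVIDEND (no `sorry`): the self-auxiliary rung plus Ribet's auxiliary prime give the
auxiliary-free statement for every semistable curve — either Skinner's `q ≠ p` exists, or `E[p]` is not
finite at `p` and `ℓ = p` is an admissible auxiliary prime. [folklore] -/
theorem semistableNoAux_of_selfaux (hR : RibetAuxPrime) (h : Rung_mult_selfaux_r0) :
    SemistableNoAuxR0 := by
  intro W _ _ p _ hp hss hm hi hL hfin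
  refine h W p hp hm hi ?_ hL hfin
  by_cases hfinite : p ∣ padicValInt p W.minimalDiscriminantInt
  · obtain ⟨ℓ, hℓ, -, hdiv, hram⟩ := hR W p hp hss hm hi hfinite
    exact ⟨ℓ, hℓ, trivial, @hss ℓ hℓ hdiv, hram⟩
  · exact ⟨p, inferInstance, trivial, hm, hfinite⟩

/-- The semistable no-aux statement also follows (trivially) from the next rung. [folklore] -/
theorem semistableNoAux_of_noaux (h : Rung_mult_noaux_r0) : SemistableNoAuxR0 :=
  fun W _ _ p _ hp _ hm hi hL hfin => h W p hp hm hi hL hfin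

/-! ### Main-conjecture vocabulary at a prime `p ‖ N` -/

/-- The Mazur–Tate–Teitelbaum allowable root at `p ‖ N`: `a_p = +1` (split) / `-1` (non-split). [folklore] -/
def multRoot (W : WeierstrassCurve ℚ) (p : ℕ) [Fact p.Prime] : ℚ_[p] :=
  if W.HasSplitMultiplicativeReductionAtPrime p then 1 else -1

/-- The exceptional-zero correction on the ALGEBRAIC side for the classical (= strict) Selmer dual
over `ℚ_∞`: `T` at a split multiplicative `p`, `1` otherwise (Skinner 2016, §3.3:
`Ch_L(f) = Ch_L(f)'·(γ - 1)` exactly in the split case, `Ch_L(f)' = (𝓛_f')`, `𝓛_f = (γ-1)𝓛_f'`;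
barrier entry `ExceptionalZeroBarrierNarrow`). [cite: Skinner2016PacificMC, §3.3] -/
def multCorr (W : WeierstrassCurve ℚ) (p : ℕ) [Fact p.Prime] : PowerSeries ℚ_[p] :=
  if W.HasSplitMultiplicativeReductionAtPrime p then PowerSeries.X else 1

/-- `IsMultPAdicLFunctionOf f p a L`: `L ∈ ℚ_p⟦T⟧` is the Mazur–Tate–Teitelbaum `p`-adic
`L`-function of the weight-2 form `f` at a prime `p ‖ N` with allowable root `a = a_p = ±1`:
bounded (`MemIwasawaRat`), constant term `(1 - a⁻¹)·[0]⁺_f` (ONE Euler factor, `ε(p) = 0`: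
MTT 1986 §I.14–I.15; `= 0` for `a = 1`, `= 2[0]⁺` for `a = -1`), and the twisted interpolation
`L(χ(γ)-1) = a^{-m} Σ_{b mod p^m} χ(b)[b/p^m]⁺_f` for every non-trivial character `χ` of `Γ` of
conductor `p^m`, copied from the prelude's `IsPAdicLFunctionOf` (whose constant clause
`(1 - a⁻¹)²[0]⁺` presumes good reduction and is NOT used here). For `a = 1` this is the tree's
`IsSplitMultPAdicLFunctionOf` (`isMult_one_iff_isSplitMult`). [cite: MazurTateTeitelbaum1986Invent, §I.14 (14.3), §I.15] -/
def IsMultPAdicLFunctionOf {N : ℕ} [NeZero N] (f : CuspForm (Gamma0 N) 2) (p : ℕ) [Fact p.Prime] (a : ℚ_[p])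
    (L : PowerSeries ℚ_[p]) : Prop :=
  MemIwasawaRat p L ∧
    PowerSeries.constantCoeff L = (1 - a⁻¹) * (ratPlusSymbol f 0 : ℚ_[p]) ∧
    ∀ (m : ℕ), 0 < m → ∀ χ : DirichletCharacter ℂ_[p] (p ^ m), χ.IsPrimitive → χ.Even →
      (∃ j : ℕ, orderOf χ = p ^ j) →
        HasSum (fun k : ℕ ↦ algebraMap ℚ_[p] ℂ_[p] (PowerSeries.coeff k L) *
            (χ (cyclotomicGenerator p : ZMod (p ^ m)) - 1) ^ k)
          (algebraMap ℚ_[p] ℂ_[p] (a⁻¹ ^ m) * ratTwistedSymbolSum f χ)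

/-- Sanity anchor: at the split root `a = 1` the predicate is the tree's
`IsSplitMultPAdicLFunctionOf` (both constant clauses read `L(0) = 0`). [folklore] -/
theorem isMult_one_iff_isSplitMult {N : ℕ} [NeZero N] (f : CuspForm (Gamma0 N) 2) (p : ℕ) [Fact p.Prime]
    (L : PowerSeries ℚ_[p]) :
    IsMultPAdicLFunctionOf f p 1 L ↔ IsSplitMultPAdicLFunctionOf f p L := by
  simp only [IsMultPAdicLFunctionOf, IsSplitMultPAdicLFunctionOf, IsPAdicLFunctionOf, inv_one,
    sub_self, zero_mul, one_pow, ne_eq, OfNat.ofNat_ne_zero, not_false_eq_true, zero_pow]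

/-- **Kato side at `p ‖ N`, INTEGRAL** (upper bound on the classical Selmer dual): for the
cyclotomic `ℤ_p`-extension with generator `γ` matching `T`, the newform `f` of `E` and the MTT
function `L`, the dual `X = X(E/ℚ_∞)` of the datum `D` is `Λ`-torsion and `L/corr_p ∈ ι(char_Λ X)`:
`∃ g ∈ char_Λ X, ι g · corr_p = L` (so `char_Λ X ∣ L/corr_p` in `Λ`). [folklore] -/
def KatoSideAt (W : WeierstrassCurve ℚ) [W.IsElliptic] [W.IsGloballyMinimal] (p : ℕ) [Fact p.Prime] :
    Prop :=
  ∀ (κ : ZpExtension ℚ p) (γ : Field.absoluteGaloisGroup ℚ), κ.IsCyclotomic → κ.IsTopGenerator γ →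
    IsCyclotomicVariable p γ →
    ∀ {N : ℕ} [NeZero N] (f : CuspForm (Gamma0 N) 2), IsNewformOf W f →
    ∀ (L : PowerSeries ℚ_[p]), IsMultPAdicLFunctionOf f p (multRoot W p) L →
    ∀ (D : W.SelmerDualData κ γ),
      D.IsTorsion ∧ ∃ g ∈ D.charIdeal, iwasawaToPowerSeries p g * multCorr W p = L

/-- **Lower-bound (Eisenstein / base-change) side at `p ‖ N`, INTEGRAL**: `char_Λ X` is principal with
a generator `g` such that `L/corr_p ∣ ι g` in `ι(Λ)`: `∃ g h, char_Λ X = (g) ∧ ι g · corr_p = L · ι h`.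
[folklore] -/
def LowerSideAt (W : WeierstrassCurve ℚ) [W.IsElliptic] [W.IsGloballyMinimal] (p : ℕ) [Fact p.Prime] :
    Prop :=
  ∀ (κ : ZpExtension ℚ p) (γ : Field.absoluteGaloisGroup ℚ), κ.IsCyclotomic → κ.IsTopGenerator γ →
    IsCyclotomicVariable p γ →
    ∀ {N : ℕ} [NeZero N] (f : CuspForm (Gamma0 N) 2), IsNewformOf W f →
    ∀ (L : PowerSeries ℚ_[p]), IsMultPAdicLFunctionOf f p (multRoot W p) L →
    ∀ (D : W.SelmerDualData κ γ),
      ∃ g h : IwasawaAlgebra p, D.charIdeal = Ideal.span {g} ∧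
        iwasawaToPowerSeries p g * multCorr W p = L * iwasawaToPowerSeries p h

/-- Barrier compatibility (BC8): at a SPLIT multiplicative `p` the typed Kato identity
`ι g · corr_p = L` forces the exceptional zero `L(0) = 0` — the blocked uncorrected shape
`char X_classical = (L_p)` (`ExceptionalZeroBarrier`, false for `X₀(11)` at `p = 11`) is not what is
asserted. [folklore] -/
theorem constantCoeff_eq_zero_of_katoSide_split {W : WeierstrassCurve ℚ} {p : ℕ} [Fact p.Prime]
    (hsplit : W.HasSplitMultiplicativeReductionAtPrime p) {g : IwasawaAlgebra p}
    {L : PowerSeries ℚ_[p]} (h : iwasawaToPowerSeries p g * multCorr W p = L) :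
    PowerSeries.constantCoeff L = 0 := by
  subst h
  simp [multCorr, hsplit]

/-! ### The five registered stubs -/

/-- Statement of `stub_kato_integral_selfaux`. [folklore] -/
def KatoIntegralSelfAux : Prop :=
  ∀ (W : WeierstrassCurve ℚ) [W.IsElliptic] [W.IsGloballyMinimal] (p : ℕ) [Fact p.Prime],
    3 ≤ p → W.HasMultiplicativeReductionAtPrime p → W.HasIrreducibleModPGaloisRep p →
    (∃ ℓ : ℕ, ∃ _ : Fact ℓ.Prime, W.HasMultiplicativeReductionAtPrime ℓ ∧
        ¬ p ∣ padicValInt ℓ W.minimalDiscriminantInt) →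
    KatoSideAt W p

/-- Statement of `stub_lower_noinert_ge5`. [folklore] -/
def LowerNoInertGe5 : Prop :=
  ∀ (W : WeierstrassCurve ℚ) [W.IsElliptic] [W.IsGloballyMinimal] (p : ℕ) [Fact p.Prime],
    5 ≤ p → W.HasMultiplicativeReductionAtPrime p → W.HasIrreducibleModPGaloisRep p → LowerSideAt W p

/-- Statement of `stub_lower_noinert_three`. [folklore] -/
def LowerNoInertThree : Prop :=
  ∀ (W : WeierstrassCurve ℚ) [W.IsElliptic] [W.IsGloballyMinimal] (p : ℕ) [Fact p.Prime],
    p = 3 → W.HasMultiplicativeReductionAtPrime p → W.HasIrreducibleModPGaloisRep p → LowerSideAt W p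

/-- Statement of `stub_greenberg_stevens`: the tree's named fact, universally closed. [folklore] -/
def GreenbergStevensAll : Prop :=
  ∀ (W : WeierstrassCurve ℚ) [W.IsElliptic] [W.IsGloballyMinimal] (p : ℕ) [Fact p.Prime],
    greenberg_stevens W p

/-- Statement of `stub_descent_r0`: Skinner's (ram)-free descent. [folklore] -/
def DescentMultR0 : Prop :=
  ∀ (W : WeierstrassCurve ℚ) [W.IsElliptic] [W.IsGloballyMinimal] (p : ℕ) [Fact p.Prime],
    3 ≤ p → W.HasMultiplicativeReductionAtPrime p → W.HasIrreducibleModPGaloisRep p →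
    W.entireLFunction 1 ≠ 0 → Finite W.sha →
    KatoSideAt W p → LowerSideAt W p → greenberg_stevens W p → PPartR0 W p

/-- **stub (α) — Kato's integral divisibility at `p ‖ N` with a SELF-admissible auxiliary prime.**
`char_Λ X(E/ℚ_∞) ∣ L_p(E,T)/corr_p` in `Λ` for `p ≥ 3` multiplicative, (irr), and some multiplicative
`ℓ` (possibly `p`) with `p ∤ ord_ℓ(Δ_min)`. Why plausibly true: Kato's Euler-system bound (Astérisque 295,
Thm. 13.4 (3) / Rubin Thm. 2.3.3) needs only (a) irreducibility and (b) some `g ∈ G_{ℚ(μ_{p^∞})}` with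
`T/(ρ(g)-1)T` free of rank one [Skinner2016PacificMC, p. 11]; for `ℓ ≠ p`, (b) is tame monodromy at `ℓ`
(ibid.); for `ℓ = p`, `g` in the inertia group of `ℚ_p(μ_{p^∞})` acts on `T_pE_{q}` by `(1 b(g); 0 1)`
with `b` the Kummer cocycle of `q_E`, non-zero mod `p` iff `q_E^{1/p} ∉ ℚ_p^{ab} = ℚ_p^{ur}(μ_{p^∞})`
iff (`p` odd, `ω ≠ 1` on `Gal(ℚ_p(μ_p)/ℚ_p)`) `q_E ∉ (ℚ_p^×)^p`, which holds when `p ∤ ord_p q_E =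
ord_p Δ_min` (`TateParameterData.valuation_q_eq_padicValInt`); the passage from Kato's bound to
`L_p` at `p ‖ N` is Kobayashi's Coleman map for the Tate curve (Doc. Math. 2006, Thm. 4.1, Cor. 4.2)
resp. Skinner 2016 §3 via congruences. Why it might fail: Kato's Thm. 17.4 as printed EXCLUDES
`p ‖ N`, `k = 2` ("additional arguments are required", [Skinner2016PacificMC, p. 11 L60–64]); the
local condition at the Tate prime and the `(γ-1)`-torsion of `H¹(ℚ_{∞,p}, T⁻)` must be threaded
through Kato's `X₀`-bound integrally. Size: M–L. [cite: Kato2004Asterisque, Thm. 17.4, Thm. 12.5 (4)] -/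
theorem stub_kato_integral_selfaux : KatoIntegralSelfAux := by
  sorry

/-- **stub (β, `p ≥ 5`) — HARDEST: the lower bound at `p ‖ N` WITHOUT an inert ramified prime.**
`L_p(E,T)/corr_p ∣ char_Λ X(E/ℚ_∞)` in `Λ` for `p ≥ 5` multiplicative and (irr) only. Intended engine:
the `p ‖ N` transplant of [BurungaleCastellaSkinner2025, §5]: base change to `M = FK` with EVERY prime of
`N` split (`n⁻ = 1`, so Wan's hypotheses (iii)–(iv) are vacuous), Wan's three-variable Greenberg
divisibility for the HIDA FAMILY through `f_E` (arXiv:2405.00270 Thm. 3.2.1 = Wan 2015 Thm. 3 /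
Wan 2020) specialised at the `p`-new weight-2 point with Castella's Hida-variable control at `p ‖ N`
[Castella2018, Thm. 4.4 and Lemma 4.3], the BDP/Greenberg-side descent, integrality from
`μ(L_𝔭^{BDP}(f_E/K)) = 0` at `p ‖ N` (Castella–Kim–Longo 2017, variation of anticyclotomic invariants in
Hida families + Burungale/Hsieh `μ = 0` at a good-weight member) in place of BCS Prop. 4.2.2, and a
two-variable zeta-element equivalence at `p ‖ N` in place of BSTW Thm. 4.1.3 (`p ∤ 2N` there).
Why it might fail: none of Wan Thm. 3.2.1 ("p > 3 good ordinary"), BSTW Thm. 4.1.3 ("p ∤ 2N"), BCS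
Prop. 4.2.2 / Lemma 5.2.3 (good reduction) is printed at `p ‖ N`; the weight-2 `p`-new specialisation of
the family divisibility is integral only after a `μ`-comparison across the family, which is exactly
what is not in print. Size: L (the content of the rung). [cite: BurungaleCastellaSkinner2025, Thm. 1.1.2, Prop. 5.2.1, Lemma 5.2.3] -/
theorem stub_lower_noinert_ge5 : LowerNoInertGe5 := by
  sorry

/-- **stub (β, `p = 3`) — the sub-case with NO engine in print.** The same lower bound at the
multiplicative prime `p = 3` under (irr) alone. Wan's `U(3,1)` divisibility and BCS require `p > 3`
(CM types / the quartic CM field), and Skinner–Urban at `p = 3` needs (ram) with `q ≠ 3`. Why plausibly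
true: it is an instance of the Iwasawa–Greenberg main conjecture. Why it might fail (as a LEMMA of this
line): no method; isolated so that a refuter can look for a `3`-adic anomaly (e.g. curves `N = 3M`)
and so that the `p ≥ 5` rung is not held hostage. Size: unknown. [cite: Skinner2016PacificMC, Thm. A (p = 3 allowed only with (ram))] -/
theorem stub_lower_noinert_three : LowerNoInertThree := by
  sorry

/-- **stub — Greenberg–Stevens** `L_p(E,0) = 0`, `[T¹]L_p · log_p γ = 𝓛_p(E) · [0]⁺_f` at split
multiplicative `p`: the tree's named fact `greenberg_stevens` (bsd.S24′; Greenberg–Stevens 1993 (0.6),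
Kobayashi 2006 Cor. 4.2), taken for every curve and prime. In print; unformalised. Size: M (given
Kobayashi's Coleman-map computation) — or cite-closed when the fact is discharged in the tree.
[cite: GreenbergStevens1993, Introduction (0.6)] -/
theorem stub_greenberg_stevens : GreenbergStevensAll := by
  sorry

/-- **stub — Skinner's (ram)-free descent in analytic rank 0** [Skinner2016PacificMC, §3.2–3.3, proof of
Thms. B and C, arXiv:1407.1093 pp. 14–15]: from the two integral divisibilities for the classical Selmer
dual with the correction `corr_p` (together: `char_Λ X = (L_p/corr_p)`), Greenberg–Stevens (split case:
`(L_p/T)(0) · log_p γ = 𝓛_p(E) L(E,1)/Ω`, `𝓛_p(E) ≠ 0` = tree theorem `LInvariant_ne_zero_holds`;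
non-split: `L_p(0) = 2 L(E,1)/Ω⁺_f`), no finite `Λ`-submodule in `X` under (irr), the control
computation `#K_ℓ = c_ℓ(T_f)`, `#K_p` (ibid. p. 15) and the period/Tamagawa comparison `Ω_f⁺ ~_p Ω_E`,
`c_ℓ(T_f) ~_p c_ℓ(E)` under (irr) (Manin constant / congruence number at `p ‖ N`: Abbes–Ullmo), plus
modularity (`exists_isNewformOf`), existence of the MTT function at `p ‖ N`
(`existsUnique_isSplitMultPAdicLFunctionOf` and its non-split twin) and of the datum `D`
(`nonempty_selmerDualData`). (ram) is used NOWHERE in these pages (it enters Thm. B only through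
Thm. A). Why it might fail: the comparison between the classical Selmer dual of the tree
(`SelmerDualData`, local Kummer conditions) and Skinner's strict module `𝒳` at the Tate prime over
`ℚ_∞` (finite index, `γ-1`-torsion) must be exact, not up to pseudo-isomorphism, for the `p`-part.
Size: L (long but charted). [cite: Skinner2016PacificMC, §3.3 (pp. 14–15 of arXiv:1407.1093)] -/
theorem stub_descent_r0 : DescentMultR0 := by
  sorry

/-! ### Composition -/

/-- A prime `p ≥ 3` is `3` or at least `5`. [folklore] -/
theorem eq_three_or_five_le {p : ℕ} [hp : Fact p.Prime] (h3 : 3 ≤ p) : p = 3 ∨ 5 ≤ p := by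
  have h4 : p ≠ 4 := by
    rintro rfl
    exact absurd hp.out (by decide)
  omega

/-- **`Rung_mult_selfaux_r0_proof` — THE SKELETON THEOREM** (the ONLY theorem of this file whose conclusion
is the rung by name; no hypotheses; sorries live only inside the five `stub_*` it invokes): case split
`p = 3 ∨ 5 ≤ p` for the lower bound, the self-admissible auxiliary prime feeds only the Kato side, then
descent. [folklore] -/
theorem Rung_mult_selfaux_r0_proof : Rung_mult_selfaux_r0 := by
  intro W _ _ p _ hp hmult hirr haux hL hfin
  have hlow : LowerSideAt W p := by
    rcases eq_three_or_five_le hp with h3 | h5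
    · exact stub_lower_noinert_three W p h3 hmult hirr
    · exact stub_lower_noinert_ge5 W p h5 hmult hirr
  obtain ⟨ℓ, hℓ, -, hmℓ, hv⟩ := haux
  exact stub_descent_r0 W p hp hmult hirr hL hfin
    (stub_kato_integral_selfaux W p hp hmult hirr ⟨ℓ, hℓ, hmℓ, hv⟩) hlow (stub_greenberg_stevens W p)

/-- **Closed composition** (sorry-free, for auditors): the five stub STATEMENTS imply the rung AND the
floor — stated as a conjunction so that `Rung_mult_selfaux_r0_proof` stays the unique rung-concluding
theorem the skeleton checker registers. [folklore] -/
theorem rung_of_stubs (h₁ : KatoIntegralSelfAux) (h₂ : LowerNoInertGe5) (h₃ : LowerNoInertThree)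
    (h₄ : GreenbergStevensAll) (h₅ : DescentMultR0) : Floor_mult_aux_r0 ∧ Rung_mult_selfaux_r0 := by
  have hr : Rung_mult_selfaux_r0 := by
    intro W _ _ p _ hp hmult hirr haux hL hfin
    have hlow : LowerSideAt W p := by
      rcases eq_three_or_five_le hp with h3 | h5
      · exact h₃ W p h3 hmult hirr
      · exact h₂ W p h5 hmult hirr
    obtain ⟨ℓ, hℓ, -, hmℓ, hv⟩ := haux
    exact h₅ W p hp hmult hirr hL hfin (h₁ W p hp hmult hirr ⟨ℓ, hℓ, hmℓ, hv⟩) hlow (h₄ W p)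
  exact ⟨floor_of_selfaux hr, hr⟩

/-- With the stubs, the floor follows too (consistency: the line re-proves Skinner's Thm. C on its
multiplicative locus, as any proof of the rung must). [folklore] -/
theorem floor_of_line : Floor_mult_aux_r0 := floor_of_selfaux Rung_mult_selfaux_r0_proof

/-- The next rung (no auxiliary hypothesis at all) implies this rung and the floor (monotonicity;
sorry-free; conjunction form for the same registration reason). [folklore] -/
theorem selfaux_of_noaux (h : Rung_mult_noaux_r0) : Floor_mult_aux_r0 ∧ Rung_mult_selfaux_r0 :=
  have hr : Rung_mult_selfaux_r0 := fun W _ _ p _ hp hm hi _ hL hfin => h W p hp hm hi hL hfin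
  ⟨floor_of_selfaux hr, hr⟩

end Summit.BirchSwinnertonDyer.BirchSwinnertonDyer.Cruxes.KatoDivisibility.RungMultSelfAux

end
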